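import Literature.ComputerArithmetic.BoldoJeannerodMelquiondMuller2023.TwoSum
import Literature.ComputerArithmetic.BoldoJeannerodMelquiondMuller2023.RoundToNearestEven
import Mathlib.Algebra.Order.Archimedean.Basic
import Mathlib.Algebra.Order.Floor.Ring
import Mathlib.Tactic.Linarith
import Mathlib.Tactic.Positivity
import Mathlib.Tactic.Ring
import Mathlib.Tactic.NormNum
import Mathlib.Tactic.GCongr

/-!
# Shewchuk (1997), §2: nonoverlapping expansions, TWO-SUM, GROW-EXPANSION, EXPANSION-SUM

J. R. Shewchuk, *Adaptive precision floating-point arithmetic and fast robust geometric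
predicates*, Discrete Comput. Geom. 18 (1997) 305–363 [Shewchuk1997], Section 2 ("Arbitrary
precision floating-point arithmetic"): the multiple-component ("expansion") arithmetic behind the
robust `orient2d` / `incircle` predicates.  This file types and proves, at FORMAT LEVEL, the
definitions of §2.1, Lemmata 1–5 and Corollary 2 of §2.2, the two error-free additions of §2.3
(FAST-TWO-SUM = Dekker, TWO-SUM = Knuth; Theorems 6, 7, Corollaries 8, 9) and the two expansion
additions of §2.4 (GROW-EXPANSION, Theorem 10 with Corollary 11; EXPANSION-SUM, Theorem 12),
including the round-to-even refinements ("nonadjacent").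

MODEL / DICTIONARY.
* Floating-point numbers are the tree's binary format `JeannerodRump2018.IsFloat p emin` over `ℚ`
  (`x = M·2^e`, `|M| < 2^p`, `e ≥ emin`: precision `p`, gradual underflow, NO overflow) and `fl` is
  ANY round-to-nearest map `IsRoundNearest p emin fl` (any tie rule); "round-to-even tiebreaking"
  is the tree's `roundTiesEven p emin` [BoldoEtAl2023, §2.2].  The paper "does not address issues
  of overflow and underflow, so the exponent is allowed to be an integer in the range [−∞, ∞]"
  (p. 308): everything below is proved in the (harder) gradual-underflow format; the only trace of
  `emin` is the side condition `emin ≤ i` (resp. `emin ≤ i + 1`) in Lemma 3, vacuous in the paper's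
  model, and absent again from Corollary 8 (sums of two floats).
* The printed hypothesis `p ≥ 3` of Theorems 7, 10, 12 serves the paper's proof of Line 4 of
  TWO-SUM via Lemma 5; the tree's proof that TWO-SUM is error-free [BoldoEtAl2023, §4.2.1;
  `twoSum_snd_eq`] needs only `p ≥ 1`, so the theorems below carry `1 ≤ p`.
* NONOVERLAPPING / NONADJACENT are typed verbatim (footnote 2, p. 309).  An expansion is a `List ℚ`
  listed from the SMALLEST component `x₁` (head) to the largest `xₙ` (the paper's index order;
  its value is `List.sum`).  "Nonoverlapping and sorted in increasing order of magnitude, except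
  that any component may be zero" is typed as `List.Pairwise (Below 1)`, and the nonadjacent
  version as `List.Pairwise (Below 2)`, where `Below c x y :↔ ∃ s, y ∈ 2^s·ℤ ∧ c·|x| < 2^s` is the
  ORIENTED form of footnote 2 (`c = 1`) resp. of non-adjacency (`c = 2`); `below_one_iff`,
  `below_two_iff`, `isExpansion_one_iff`, `isExpansion_two_iff` prove that for floating-point
  components these are exactly the paper's notions.
* `err(a ⊕ b) = (a ⊕ b) − (a + b)` (p. 310: `a ⊛ b = a ∗ b + err(a ⊛ b)`).

PROVED HERE (statement-by-statement list in the docstrings): Lemma 1 (+ subtraction), Corollary 2,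
Lemma 3 (a)(b), Lemma 4 (+ subtraction), Lemma 5 (Sterbenz, two-sided interval), Theorem 6
(FAST-TWO-SUM exact + nonoverlapping) and FAST-TWO-DIFF, Theorem 7 (TWO-SUM exact + nonoverlapping;
TWO-SUM(a, b) is the tree's `2Sum(b, a)`), Corollary 8 (a)(b) (every integer `i`), Corollary 9
(round-to-even ⟹ nonadjacent; in fact `t − RNₑ(t)` lies 2-below `RNₑ(t)` for every rational `t`),
Theorem 10 (GROW-EXPANSION: exact sum, `m + 1` components, nonoverlapping resp. nonadjacent,
`h_{m+1} = Q_m`), the zero-component "pipeline delay" remark (p. 317), Corollary 11, Theorem 12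
(EXPANSION-SUM, windowed Line 3: exact sum, `m + n` components, nonoverlapping resp. nonadjacent).
The proofs of Theorems 10 and 12 are the paper's ("`hᵢ` cannot overlap any of the later components
of `h`, because these are constructed by summing `Qᵢ` with later `e` components") made explicit as
a GRID INVARIANT: all later components are integer multiples of a common quantum `2^g ≥ c·|hᵢ|`,
and rounding preserves integer multiples of `2^g`, `g ≥ emin` [BoldoEtAl2023, Property 2.2].

NOT TYPED: TWO-DIFF (p. 315; its Line 2 `a ⊖ x` is not the mirror image of TWO-SUM's under an
asymmetric tie rule, so it is not a corollary of Theorem 7 and would need its own three-case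
proof); §2.4–2.5 FAST-EXPANSION-SUM (Theorem 13, strongly nonoverlapping inputs, round-to-even;
Lemmata 14–16), LINEAR-EXPANSION-SUM (Theorem 24, Appendix B), §2.6 SCALE-EXPANSION (Theorem 19),
§2.7 COMPRESS (Theorem 23), §2.8 and the adaptive predicates of §§3–4.
-/

namespace Literature.ComputerArithmetic.Shewchuk1997

open Literature.ComputerArithmetic.JeannerodRump2018
open Literature.ComputerArithmetic.BoldoJeannerodMelquiondMuller2023 hiding twoSum

variable {p : ℕ} {emin : ℤ} {fl : ℚ → ℚ}

/-! ### §2.1 Nonoverlapping, nonadjacent, expansions -/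

/-- **Nonoverlapping** (footnote 2, verbatim): "`x` and `y` are nonoverlapping if there exist
integers `r` and `s` such that `x = r2^s` and `|y| < 2^s`, or `y = r2^s` and `|x| < 2^s`" — "the
least significant nonzero bit of `x` is more significant than the most significant nonzero bit of
`y`, or vice versa ... The number zero does not overlap any number."
[cite: Shewchuk1997, §2.1 p. 309 and footnote 2] -/
def Nonoverlapping (x y : ℚ) : Prop :=
  (∃ r s : ℤ, x = (r : ℚ) * (2 : ℚ) ^ s ∧ |y| < (2 : ℚ) ^ s) ∨
    (∃ r s : ℤ, y = (r : ℚ) * (2 : ℚ) ^ s ∧ |x| < (2 : ℚ) ^ s)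

/-- **Nonadjacent**: "`x` and `y` are adjacent if they overlap, if `x` overlaps `2y`, or if `2x`
overlaps `y`"; non-adjacency is the negation, written out. [cite: Shewchuk1997, §2.1 p. 309] -/
def Nonadjacent (x y : ℚ) : Prop :=
  Nonoverlapping x y ∧ Nonoverlapping x (2 * y) ∧ Nonoverlapping (2 * x) y

/-- `y` is an integer multiple of the quantum `2^s`. [cite: Shewchuk1997, §2.1 footnote 2] -/
def OnGrid (s : ℤ) (y : ℚ) : Prop := ∃ r : ℤ, y = (r : ℚ) * (2 : ℚ) ^ s

/-- ORIENTED GAP CONDITION `Below c x y`: `y = r·2^s` for some integers `r, s` with `c·|x| < 2^s`.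
For `c = 1` this is footnote 2 read with `x` the less significant number ("`y = r2^s` and
`|x| < 2^s`"); for `c = 2` it says moreover that a zero bit separates them (nonadjacent); see
`below_one_iff`, `below_two_iff`. [cite: Shewchuk1997, §2.1 p. 309 and footnote 2] -/
def Below (c : ℚ) (x y : ℚ) : Prop := ∃ s : ℤ, OnGrid s y ∧ c * |x| < (2 : ℚ) ^ s

/-- An EXPANSION `x = xₙ + ⋯ + x₂ + x₁` is the list `[x₁, x₂, …, xₙ]` of its components, smallest
first; `IsExpansion c` says that every earlier component lies `c`-below every later one:
`c = 1` — "nonoverlapping ... sorted in order of increasing magnitude, except that any of the `xᵢ`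
may be zero"; `c = 2` — the same with "nonadjacent" (`isExpansion_one_iff`, `isExpansion_two_iff`).
[cite: Shewchuk1997, §2.1 p. 309; Thm 10 p. 316] -/
def IsExpansion (c : ℚ) (l : List ℚ) : Prop := l.Pairwise (Below c)

/-! #### Bookkeeping for grids and gaps -/

/-- Zero lies on every grid ("The number zero does not overlap any number"). [cite: Shewchuk1997, §2.1 p. 309] -/
theorem OnGrid.zero (s : ℤ) : OnGrid s 0 := ⟨0, by simp⟩

/-- A multiple of `2^s'` is a multiple of every finer quantum `2^s`, `s ≤ s'`.
[cite: Shewchuk1997, §2.1 footnote 2] -/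
theorem OnGrid.mono {s s' : ℤ} {y : ℚ} (h : OnGrid s' y) (hs : s ≤ s') : OnGrid s y := by
  obtain ⟨r, rfl⟩ := h
  obtain ⟨d, hd⟩ := Int.eq_ofNat_of_zero_le (sub_nonneg.mpr hs)
  refine ⟨r * 2 ^ d, ?_⟩
  rw [show s' = s + (d : ℤ) by omega, zpow_add₀ (by norm_num : (2 : ℚ) ≠ 0), zpow_natCast]
  push_cast; ring

/-- Grids are closed under addition. [cite: Shewchuk1997, §2.1 footnote 2] -/
theorem OnGrid.add {s : ℤ} {a b : ℚ} (ha : OnGrid s a) (hb : OnGrid s b) : OnGrid s (a + b) := by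
  obtain ⟨m, rfl⟩ := ha; obtain ⟨n, rfl⟩ := hb; exact ⟨m + n, by push_cast; ring⟩

/-- Grids are closed under negation. [cite: Shewchuk1997, §2.1 footnote 2] -/
theorem OnGrid.neg {s : ℤ} {a : ℚ} (ha : OnGrid s a) : OnGrid s (-a) := by
  obtain ⟨m, rfl⟩ := ha; exact ⟨-m, by push_cast; ring⟩

/-- Grids are closed under subtraction. [cite: Shewchuk1997, §2.1 footnote 2] -/
theorem OnGrid.sub {s : ℤ} {a b : ℚ} (ha : OnGrid s a) (hb : OnGrid s b) : OnGrid s (a - b) := by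
  rw [sub_eq_add_neg]; exact ha.add hb.neg

/-- A float is an integer multiple of `2^emin`. [cite: Shewchuk1997, §2.1 p. 308 (model)] -/
theorem OnGrid.of_isFloat {y : ℚ} (hy : IsFloat p emin y) : OnGrid emin y :=
  hy.exists_int_mul_zpow_emin

/-- Rounding preserves the grid `2^s·ℤ` for `s ≥ emin` [BoldoEtAl2023, Property 2.2] — the formal
content of "the later components of `h` ... are constructed by summing `Qᵢ` with later `e`
components" in the proof of Theorem 10. [cite: Shewchuk1997, Thm 10 p. 317 (proof)] -/
theorem OnGrid.fl_of (hp : 1 ≤ p) (hfl : IsRoundNearest p emin fl) {s : ℤ} (hs : emin ≤ s)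
    {t : ℚ} (h : OnGrid s t) : OnGrid s (fl t) := by
  obtain ⟨N, rfl⟩ := h; exact exists_fl_eq_int_mul hp hfl N hs

/-- A nonzero multiple of `2^s` has magnitude `≥ 2^s`. [cite: Shewchuk1997, §2.1 p. 309] -/
theorem OnGrid.two_zpow_le_abs {s : ℤ} {y : ℚ} (h : OnGrid s y) (hy : y ≠ 0) :
    (2 : ℚ) ^ s ≤ |y| := by
  obtain ⟨r, rfl⟩ := h
  have hr : r ≠ 0 := by rintro rfl; simp at hy
  have h1 : (1 : ℚ) ≤ |(r : ℚ)| := by rw [← Int.cast_abs]; exact_mod_cast Int.one_le_abs hr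
  rw [abs_mul, abs_of_pos (zpow_pos (by norm_num : (0 : ℚ) < 2) s)]
  exact le_mul_of_one_le_left (zpow_pos (by norm_num : (0 : ℚ) < 2) s).le h1

/-- Constructor for the oriented gap condition. [cite: Shewchuk1997, §2.1 footnote 2] -/
theorem Below.of_onGrid {c x y : ℚ} {s : ℤ} (hy : OnGrid s y) (hx : c * |x| < (2 : ℚ) ^ s) :
    Below c x y := ⟨s, hy, hx⟩

/-- A smaller number inherits the gap ("By Lemma 1, `|hᵢ| ≤ |eᵢ|` ... `hᵢ` cannot overlap any of
`eᵢ₊₁, eᵢ₊₂, …`"). [cite: Shewchuk1997, Thm 10 p. 317 (proof)] -/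
theorem Below.mono_left {c x x' y : ℚ} (h : Below c x y) (hc : 0 ≤ c) (hx : |x'| ≤ |x|) :
    Below c x' y := by
  obtain ⟨s, hy, hlt⟩ := h
  exact ⟨s, hy, lt_of_le_of_lt (mul_le_mul_of_nonneg_left hx hc) hlt⟩

/-- "Any nonadjacent expansion is ... nonoverlapping": the gap condition weakens in `c`.
[cite: Shewchuk1997, §2.4 p. 319] -/
theorem Below.anti {c c' x y : ℚ} (h : Below c x y) (hc : c' ≤ c) : Below c' x y := by
  obtain ⟨s, hy, hlt⟩ := h
  exact ⟨s, hy, lt_of_le_of_lt (mul_le_mul_of_nonneg_right hc (abs_nonneg x)) hlt⟩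

/-- "The number zero does not overlap any number" (right). [cite: Shewchuk1997, §2.1 p. 309] -/
theorem below_zero_right (c x : ℚ) : Below c x 0 := by
  obtain ⟨n, hn⟩ := pow_unbounded_of_one_lt (c * |x|) (by norm_num : (1 : ℚ) < 2)
  exact ⟨n, OnGrid.zero _, by rwa [zpow_natCast]⟩

/-- "The number zero does not overlap any number" (left; the other number a float).
[cite: Shewchuk1997, §2.1 p. 309] -/
theorem below_zero_left {y : ℚ} (hy : IsFloat p emin y) (c : ℚ) : Below c 0 y := by
  obtain ⟨M, e, -, -, rfl⟩ := hy
  exact ⟨e, ⟨M, rfl⟩, by rw [abs_zero, mul_zero]; exact zpow_pos (by norm_num) _⟩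

/-- The witness quantum of a float may be taken `≥ 2^emin`. [cite: Shewchuk1997, §2.1 p. 309] -/
theorem Below.normalize {c x y : ℚ} (h : Below c x y) (hy : IsFloat p emin y) :
    ∃ s : ℤ, emin ≤ s ∧ OnGrid s y ∧ c * |x| < (2 : ℚ) ^ s := by
  obtain ⟨s, hs, hlt⟩ := h
  rcases le_or_gt emin s with h1 | h1
  · exact ⟨s, h1, hs, hlt⟩
  · exact ⟨emin, le_rfl, OnGrid.of_isFloat hy,
      lt_of_lt_of_le hlt (zpow_le_zpow_right₀ (by norm_num) h1.le)⟩

/-- A number lying (`c ≥ 1`)-below a NONZERO number is smaller in magnitude ("sorted in order of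
increasing magnitude, except that any of the `xᵢ` may be zero"). [cite: Shewchuk1997, Thm 10 p. 316] -/
theorem Below.abs_lt {c x y : ℚ} (h : Below c x y) (hc : 1 ≤ c) (hy : y ≠ 0) : |x| < |y| := by
  obtain ⟨s, hs, hlt⟩ := h
  have h1 : |x| ≤ c * |x| := le_mul_of_one_le_left (abs_nonneg x) hc
  have h2 := hs.two_zpow_le_abs hy
  linarith

/-! #### The oriented conditions are the paper's notions -/

/-- Nonoverlapping is symmetric ("or vice versa"). [cite: Shewchuk1997, §2.1 p. 309] -/
theorem nonoverlapping_comm {x y : ℚ} : Nonoverlapping x y ↔ Nonoverlapping y x :=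
  ⟨fun h => h.symm, fun h => h.symm⟩

/-- `Below 1 x y` ⟹ `x`, `y` nonoverlapping (second clause of footnote 2).
[cite: Shewchuk1997, §2.1 footnote 2] -/
theorem Below.nonoverlapping {x y : ℚ} (h : Below 1 x y) : Nonoverlapping x y := by
  obtain ⟨s, ⟨r, hr⟩, hlt⟩ := h
  exact Or.inr ⟨r, s, hr, by simpa using hlt⟩

/-- `Below 2 x y` ⟹ `x`, `y` nonadjacent. [cite: Shewchuk1997, §2.1 p. 309] -/
theorem Below.nonadjacent {x y : ℚ} (h : Below 2 x y) : Nonadjacent x y := by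
  obtain ⟨s, ⟨r, hr⟩, hlt⟩ := h
  have h2s : (0 : ℚ) < (2 : ℚ) ^ s := zpow_pos (by norm_num) _
  have hx : |x| < (2 : ℚ) ^ s := by linarith [abs_nonneg x]
  refine ⟨Or.inr ⟨r, s, hr, hx⟩, Or.inr ⟨r, s + 1, ?_, ?_⟩, Or.inr ⟨r, s, hr, ?_⟩⟩
  · rw [hr, zpow_add_one₀ (by norm_num : (2 : ℚ) ≠ 0)]; ring
  · rw [zpow_add_one₀ (by norm_num : (2 : ℚ) ≠ 0)]; linarith [abs_nonneg x]
  · rwa [abs_mul, abs_two]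

/-- If `x = r·2^s` with `|x| < |y| < 2^s` then `x = 0` (the first clause of footnote 2 cannot hold
for the smaller number unless it vanishes). [cite: Shewchuk1997, §2.1 footnote 2] -/
theorem eq_zero_of_onGrid_of_abs_lt {x y : ℚ} {s : ℤ} (hx : OnGrid s x) (hxy : |x| < |y|)
    (hy : |y| < (2 : ℚ) ^ s) : x = 0 := by
  by_contra h0
  have := hx.two_zpow_le_abs h0
  linarith

/-- **DICTIONARY, nonoverlapping**: for a floating-point `y`, `x` lies 1-below `y` iff `x` and `y`
are nonoverlapping and ordered by magnitude up to zeros.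
[cite: Shewchuk1997, §2.1 p. 309 and footnote 2; Thm 10 p. 316] -/
theorem below_one_iff {x y : ℚ} (hy : IsFloat p emin y) :
    Below 1 x y ↔ Nonoverlapping x y ∧ (x = 0 ∨ y = 0 ∨ |x| < |y|) := by
  constructor
  · intro h
    refine ⟨h.nonoverlapping, ?_⟩
    by_cases hy0 : y = 0
    · exact Or.inr (Or.inl hy0)
    · exact Or.inr (Or.inr (h.abs_lt le_rfl hy0))
  · rintro ⟨hno, hord⟩
    rcases hord with rfl | rfl | hlt
    · exact below_zero_left hy 1
    · exact below_zero_right 1 x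
    · rcases hno with ⟨r, s, hxr, hys⟩ | ⟨r, s, hyr, hxs⟩
      · rw [eq_zero_of_onGrid_of_abs_lt ⟨r, hxr⟩ hlt hys]; exact below_zero_left hy 1
      · exact ⟨s, ⟨r, hyr⟩, by rwa [one_mul]⟩

/-- **DICTIONARY, nonadjacent**: for a floating-point `y`, `x` lies 2-below `y` iff `x` and `y` are
nonadjacent and ordered by magnitude up to zeros. [cite: Shewchuk1997, §2.1 p. 309; Thm 10 p. 316] -/
theorem below_two_iff {x y : ℚ} (hy : IsFloat p emin y) :
    Below 2 x y ↔ Nonadjacent x y ∧ (x = 0 ∨ y = 0 ∨ |x| < |y|) := by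
  constructor
  · intro h
    refine ⟨h.nonadjacent, ?_⟩
    by_cases hy0 : y = 0
    · exact Or.inr (Or.inl hy0)
    · exact Or.inr (Or.inr (h.abs_lt (by norm_num) hy0))
  · rintro ⟨⟨hno, -, hno2⟩, hord⟩
    rcases hord with rfl | rfl | hlt
    · exact below_zero_left hy 2
    · exact below_zero_right 2 x
    · by_cases hx0 : x = 0
      · rw [hx0]; exact below_zero_left hy 2
      have hy0 : y ≠ 0 := by
        rintro rfl; exact hx0 (abs_eq_zero.mp (le_antisymm (by simpa using hlt.le) (abs_nonneg x)))
      have h2 : (0 : ℚ) < 2 := by norm_num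
      -- footnote 2 for `(x, y)`: the smaller number is the one below the quantum
      obtain ⟨r, s, hyr, hxs⟩ : ∃ r s : ℤ, y = (r : ℚ) * (2 : ℚ) ^ s ∧ |x| < (2 : ℚ) ^ s := by
        rcases hno with ⟨r, s, hxr, hys⟩ | h
        · exact absurd (eq_zero_of_onGrid_of_abs_lt ⟨r, hxr⟩ hlt hys) hx0
        · exact h
      -- footnote 2 for `(2x, y)`
      rcases hno2 with ⟨r', s', hxr', hys'⟩ | ⟨r', s', hyr', hxs'⟩
      · -- `2x = r'·2^s'`, `|y| < 2^s'`: then `|r'| = 1`, `|x| = 2^(s'-1)`, and `y ∈ 2^s ℤ` with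
        -- `2^s' ≤ 2^s ≤ |y|` — contradiction
        exfalso
        have h2s' : (0 : ℚ) < (2 : ℚ) ^ s' := zpow_pos h2 _
        have hr'abs : |((r' : ℤ) : ℚ)| * (2 : ℚ) ^ s' = 2 * |x| := by
          have h := congrArg abs hxr'
          rw [abs_mul, abs_mul, abs_two, abs_of_pos h2s'] at h
          exact h.symm
        have hr'lt : |((r' : ℤ) : ℚ)| < 2 := by
          have : |((r' : ℤ) : ℚ)| * (2 : ℚ) ^ s' < 2 * (2 : ℚ) ^ s' := by
            rw [hr'abs]; linarith
          exact lt_of_mul_lt_mul_right this h2s'.le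
        have hr'0 : r' ≠ 0 := by
          rintro rfl; apply hx0; simpa using hxr'
        have hr'1 : |r'| = 1 := by
          have h1 := Int.one_le_abs hr'0
          have h2' : |r'| < 2 := by rw [← Int.cast_abs] at hr'lt; exact_mod_cast hr'lt
          omega
        have hx2 : 2 * |x| = (2 : ℚ) ^ s' := by
          rw [← hr'abs, ← Int.cast_abs, hr'1]; simp
        have hss' : s' ≤ s := by
          have : (2 : ℚ) ^ s' < (2 : ℚ) ^ (s + 1) := by
            rw [zpow_add_one₀ (by norm_num : (2 : ℚ) ≠ 0)]; linarith
          have := (zpow_lt_zpow_iff_right₀ (by norm_num : (1 : ℚ) < 2)).mp this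
          omega
        have hys : (2 : ℚ) ^ s ≤ |y| := OnGrid.two_zpow_le_abs ⟨r, hyr⟩ hy0
        have : (2 : ℚ) ^ s' ≤ (2 : ℚ) ^ s := zpow_le_zpow_right₀ (by norm_num) hss'
        linarith
      · exact ⟨s', ⟨r', hyr'⟩, by rwa [abs_mul, abs_two] at hxs'⟩

/-- The empty expansion. [cite: Shewchuk1997, §2.1 p. 309] -/
theorem isExpansion_nil (c : ℚ) : IsExpansion c [] := List.Pairwise.nil

/-- A one-component expansion. [cite: Shewchuk1997, §2.1 p. 309] -/
theorem isExpansion_singleton (c x : ℚ) : IsExpansion c [x] := List.pairwise_singleton _ _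

/-- Unfolding an expansion at its smallest component: `x₁` lies `c`-below every later component and
the rest is an expansion. [cite: Shewchuk1997, §2.1 p. 309; Thm 10 p. 316] -/
theorem isExpansion_cons {c x : ℚ} {l : List ℚ} :
    IsExpansion c (x :: l) ↔ (∀ y ∈ l, Below c x y) ∧ IsExpansion c l := List.pairwise_cons

/-- "Any nonadjacent expansion is ... nonoverlapping" (and generally the property weakens in `c`).
[cite: Shewchuk1997, §2.4 p. 319] -/
theorem IsExpansion.anti {c c' : ℚ} {l : List ℚ} (h : IsExpansion c l) (hc : c' ≤ c) :
    IsExpansion c' l := List.Pairwise.imp (fun hxy => hxy.anti hc) h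

/-- **DICTIONARY, nonoverlapping expansion**: for floating-point components, `IsExpansion 1 l` iff
the components are pairwise nonoverlapping and "sorted in order of increasing magnitude, except that
any of the `xᵢ` may be zero". [cite: Shewchuk1997, §2.1 p. 309; Thm 10 p. 316] -/
theorem isExpansion_one_iff {l : List ℚ} (hl : ∀ x ∈ l, IsFloat p emin x) :
    IsExpansion 1 l ↔
      l.Pairwise Nonoverlapping ∧ l.Pairwise (fun x y => x = 0 ∨ y = 0 ∨ |x| < |y|) := by
  rw [← List.pairwise_and_iff]
  exact List.Pairwise.iff_of_mem (fun _ hy => below_one_iff (hl _ hy))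

/-- **DICTIONARY, nonadjacent expansion**: for floating-point components, `IsExpansion 2 l` iff the
components are pairwise nonadjacent and sorted in increasing magnitude up to zeros.
[cite: Shewchuk1997, §2.1 p. 309; Thm 10 p. 316] -/
theorem isExpansion_two_iff {l : List ℚ} (hl : ∀ x ∈ l, IsFloat p emin x) :
    IsExpansion 2 l ↔
      l.Pairwise Nonadjacent ∧ l.Pairwise (fun x y => x = 0 ∨ y = 0 ∨ |x| < |y|) := by
  rw [← List.pairwise_and_iff]
  exact List.Pairwise.iff_of_mem (fun _ hy => below_two_iff (hl _ hy))

/-! ### §2.2 Properties of binary arithmetic (Lemmata 1–5) -/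

/-- **LEMMA 1.** "Let `a ⊕ b = a + b + err(a ⊕ b)`. The roundoff error `|err(a ⊕ b)|` is no larger
than `|a|` or `|b|`" (`a`, `b` floats: each is a rounding candidate).
[cite: Shewchuk1997, Lemma 1 p. 310] -/
theorem abs_err_add_le (hfl : IsRoundNearest p emin fl) {a b : ℚ} (ha : IsFloat p emin a)
    (hb : IsFloat p emin b) : |fl (a + b) - (a + b)| ≤ |a| ∧ |fl (a + b) - (a + b)| ≤ |b| :=
  ⟨by have := abs_err_le_abs_operand hfl hb a; rwa [add_comm b a] at this,
    abs_err_le_abs_operand hfl ha b⟩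

/-- **LEMMA 1**, "(An analogous result holds for subtraction.)": `|err(a ⊖ b)| ≤ |a|, |b|`.
[cite: Shewchuk1997, Lemma 1 p. 310] -/
theorem abs_err_sub_le (hfl : IsRoundNearest p emin fl) {a b : ℚ} (ha : IsFloat p emin a)
    (hb : IsFloat p emin b) : |fl (a - b) - (a - b)| ≤ |a| ∧ |fl (a - b) - (a - b)| ≤ |b| := by
  have h := abs_err_add_le hfl ha hb.neg
  rw [abs_neg, ← sub_eq_add_neg] at h
  exact h

/-- **COROLLARY 2.** "The roundoff error `err(a ⊕ b)` can be expressed with a `p`-bit significand"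
(it is a float; with gradual underflow [BoldoEtAl2023, Property 2.11]).
[cite: Shewchuk1997, Cor 2 p. 311] -/
theorem isFloat_err_add (hp : 1 ≤ p) (hfl : IsRoundNearest p emin fl) {a b : ℚ}
    (ha : IsFloat p emin a) (hb : IsFloat p emin b) :
    IsFloat p emin (fl (a + b) - (a + b)) ∧ IsFloat p emin (a + b - fl (a + b)) :=
  ⟨isFloat_fl_add_sub hp hfl ha hb, isFloat_add_sub_fl hp hfl ha hb⟩

/-- The rounding error is at most the distance from `|t|` to any float `m` (use the candidate
`±m` with the sign of `t`). [cite: Shewchuk1997, Lemma 3 p. 311 (proof)] -/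
theorem abs_sub_fl_le_abs_abs_sub (hfl : IsRoundNearest p emin fl) (t : ℚ) {m : ℚ}
    (hm : IsFloat p emin m) : |t - fl t| ≤ |(|t| - m)| := by
  rcases le_or_gt 0 t with ht | ht
  · rw [abs_of_nonneg ht]; exact abs_sub_fl_le hfl t hm
  · have h := abs_sub_fl_le hfl t hm.neg
    rw [abs_of_neg ht, show -t - m = -(t - -m) by ring, abs_neg]
    exact h

/-- **LEMMA 3 (a)**, contrapositive form, for an arbitrary exact result `t`: if
`|t| < 2^i(2^p + 1)` then `|err| = |t − fl t| < 2^i` ("the numbers `2^i·2^p, 2^i(2^p − 1), …, 0`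
are all expressible in `p` bits" — in the gradual-underflow format this needs `i ≥ emin`).
[cite: Shewchuk1997, Lemma 3(a) p. 311] -/
theorem abs_err_lt_two_zpow (hp : 1 ≤ p) (hfl : IsRoundNearest p emin fl) {i : ℤ} (hi : emin ≤ i)
    {t : ℚ} (ht : |t| < (2 : ℚ) ^ i * (2 ^ p + 1)) : |t - fl t| < (2 : ℚ) ^ i := by
  have h2i : (0 : ℚ) < (2 : ℚ) ^ i := zpow_pos (by norm_num) _
  set j : ℤ := ⌊|t| / (2 : ℚ) ^ i⌋ with hj
  have hj0 : 0 ≤ j := Int.floor_nonneg.mpr (div_nonneg (abs_nonneg t) h2i.le)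
  have hjle : (j : ℚ) * (2 : ℚ) ^ i ≤ |t| := by
    have := Int.floor_le (|t| / (2 : ℚ) ^ i); rwa [le_div_iff₀ h2i] at this
  have hjlt : |t| < (j : ℚ) * (2 : ℚ) ^ i + (2 : ℚ) ^ i := by
    have := Int.lt_floor_add_one (|t| / (2 : ℚ) ^ i)
    rw [div_lt_iff₀ h2i, add_mul, one_mul] at this; exact this
  have hjp : |j| ≤ 2 ^ p := by
    rw [abs_of_nonneg hj0]
    have h1 : (j : ℚ) * (2 : ℚ) ^ i < (2 ^ p + 1) * (2 : ℚ) ^ i := by linarith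
    have h2 : (j : ℚ) < 2 ^ p + 1 := lt_of_mul_lt_mul_right h1 h2i.le
    have h3 : j < 2 ^ p + 1 := by exact_mod_cast h2
    omega
  have hcand : IsFloat p emin ((j : ℚ) * (2 : ℚ) ^ i) := isFloat_of_abs_le hp hjp hi
  calc |t - fl t| ≤ |(|t| - (j : ℚ) * (2 : ℚ) ^ i)| := abs_sub_fl_le_abs_abs_sub hfl t hcand
    _ = |t| - (j : ℚ) * (2 : ℚ) ^ i := abs_of_nonneg (by linarith)
    _ < (2 : ℚ) ^ i := by linarith

/-- **LEMMA 3 (b)**, contrapositive form: if `|t| ≤ 2^i(2^(p+1) + 1)` then `|t − fl t| ≤ 2^i`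
("the numbers `2^i·2^(p+1), 2^i(2^(p+1) − 2), …, 0` are all expressible in `p` bits. Any value
`|a ∗ b| ≤ 2^i(2^(p+1) + 1)` is within a distance of `2^i` from one of these numbers"; needs
`i + 1 ≥ emin`). [cite: Shewchuk1997, Lemma 3(b) p. 311] -/
theorem abs_err_le_two_zpow (hp : 1 ≤ p) (hfl : IsRoundNearest p emin fl) {i : ℤ}
    (hi : emin ≤ i + 1) {t : ℚ} (ht : |t| ≤ (2 : ℚ) ^ i * (2 ^ (p + 1) + 1)) :
    |t - fl t| ≤ (2 : ℚ) ^ i := by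
  have h2 : (0 : ℚ) < 2 := by norm_num
  have h2i : (0 : ℚ) < (2 : ℚ) ^ i := zpow_pos h2 _
  set u : ℚ := (2 : ℚ) ^ (i + 1) with hu
  have hu2 : u = 2 * (2 : ℚ) ^ i := by rw [hu, zpow_add_one₀ (by norm_num : (2 : ℚ) ≠ 0)]; ring
  have hu0 : 0 < u := by rw [hu2]; positivity
  set j : ℤ := ⌈|t| / u - 1 / 2⌉ with hj
  have hjge : |t| / u - 1 / 2 ≤ j := Int.le_ceil _
  have hjlt : (j : ℚ) < |t| / u - 1 / 2 + 1 := Int.ceil_lt_add_one _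
  have hj0 : 0 ≤ j := by
    have : (-1 : ℤ) < j := by
      rw [hj, Int.lt_ceil]; push_cast
      linarith [div_nonneg (abs_nonneg t) hu0.le]
    omega
  have hjp : |j| ≤ 2 ^ p := by
    rw [abs_of_nonneg hj0, hj, Int.ceil_le]
    push_cast
    rw [sub_le_iff_le_add, div_le_iff₀ hu0, hu2]
    calc |t| ≤ (2 : ℚ) ^ i * (2 ^ (p + 1) + 1) := ht
      _ = (2 ^ p + 1 / 2) * (2 * (2 : ℚ) ^ i) := by rw [pow_succ]; ring
  have hcand : IsFloat p emin ((j : ℚ) * u) := isFloat_of_abs_le hp hjp hi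
  have hlo : |t| - u / 2 ≤ (j : ℚ) * u := by
    have := mul_le_mul_of_nonneg_right hjge hu0.le
    rw [sub_mul, div_mul_cancel₀ _ hu0.ne'] at this
    linarith
  have hhi : (j : ℚ) * u < |t| + u / 2 := by
    have := mul_lt_mul_of_pos_right hjlt hu0
    rw [add_mul, sub_mul, div_mul_cancel₀ _ hu0.ne', one_mul] at this
    linarith
  calc |t - fl t| ≤ |(|t| - (j : ℚ) * u)| := abs_sub_fl_le_abs_abs_sub hfl t hcand
    _ ≤ u / 2 := abs_le.mpr ⟨by linarith, by linarith⟩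
    _ = (2 : ℚ) ^ i := by rw [hu2]; ring

/-- **LEMMA 4.** "Suppose that `|a + b| ≤ |a|` and `|a + b| ≤ |b|`. Then `a ⊕ b = a + b`" (the sum is
a float). [cite: Shewchuk1997, Lemma 4 p. 311] -/
theorem fl_add_eq_self_of_abs_add_le (hfl : IsRoundNearest p emin fl) {a b : ℚ}
    (ha : IsFloat p emin a) (hb : IsFloat p emin b) (h1 : |a + b| ≤ |a|) (h2 : |a + b| ≤ |b|) :
    IsFloat p emin (a + b) ∧ fl (a + b) = a + b := by
  have hF : IsFloat p emin (a + b) := by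
    rcases le_total |b| |a| with hba | hab
    · exact isFloat_add_of_abs_add_le ha hb hba h2
    · have := isFloat_add_of_abs_add_le hb ha hab (by rwa [add_comm]); rwa [add_comm] at this
  exact ⟨hF, fl_eq_self hfl hF⟩

/-- **LEMMA 4**, "(An analogous result holds for subtraction.)"
[cite: Shewchuk1997, Lemma 4 p. 311] -/
theorem fl_sub_eq_self_of_abs_sub_le (hfl : IsRoundNearest p emin fl) {a b : ℚ}
    (ha : IsFloat p emin a) (hb : IsFloat p emin b) (h1 : |a - b| ≤ |a|) (h2 : |a - b| ≤ |b|) :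
    IsFloat p emin (a - b) ∧ fl (a - b) = a - b := by
  have h := fl_add_eq_self_of_abs_add_le hfl ha hb.neg (by rwa [← sub_eq_add_neg])
    (by rwa [abs_neg, ← sub_eq_add_neg])
  rwa [← sub_eq_add_neg] at h

/-- **LEMMA 5 (Sterbenz).** "Suppose that `b ∈ [a/2, 2a]`. Then `a ⊖ b = a − b`" — the interval is
read between its endpoints for either sign of `a`. [cite: Shewchuk1997, Lemma 5 p. 312] -/
theorem fl_sub_eq_self_of_mem_interval (hfl : IsRoundNearest p emin fl) {a b : ℚ}
    (ha : IsFloat p emin a) (hb : IsFloat p emin b)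
    (h1 : min (a / 2) (2 * a) ≤ b) (h2 : b ≤ max (a / 2) (2 * a)) :
    IsFloat p emin (a - b) ∧ fl (a - b) = a - b := by
  have hF : IsFloat p emin (a - b) := by
    rcases le_or_gt 0 a with ha0 | ha0
    · rw [min_eq_left (by linarith), max_eq_right (by linarith)] at *
      exact sterbenz ha hb h1 h2
    · rw [min_eq_right (by linarith), max_eq_left (by linarith)] at *
      have := (sterbenz ha.neg hb.neg (by linarith) (by linarith)).neg
      rwa [show -(-a - -b) = a - b by ring] at this
  exact ⟨hF, fl_eq_self hfl hF⟩

/-! ### §2.3 Simple addition: FAST-TWO-SUM and TWO-SUM -/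

/-- **FAST-TWO-SUM(a, b)** (Dekker): `x ⇐ a ⊕ b`; `b_virtual ⇐ x ⊖ a`; `y ⇐ b ⊖ b_virtual`;
`return (x, y)` — literally the tree's `fast2Sum` [BoldoEtAl2023, Algorithm 1].
[cite: Shewchuk1997, Thm 6 p. 312] -/
def fastTwoSum (fl : ℚ → ℚ) (a b : ℚ) : ℚ × ℚ :=
  let x := fl (a + b)
  let bvirtual := fl (x - a)
  (x, fl (b - bvirtual))

/-- FAST-TWO-SUM is the tree's `fast2Sum` [BoldoEtAl2023, Algorithm 1], definitionally.
[cite: Shewchuk1997, Thm 6 p. 312] -/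
theorem fastTwoSum_eq_fast2Sum (fl : ℚ → ℚ) (a b : ℚ) : fastTwoSum fl a b = fast2Sum fl a b := rfl

/-- **THEOREM 6 (FAST-TWO-SUM is exact)**: for floats `|a| ≥ |b|`, Line 2 is exact
(`b_virtual = x − a`), `y = −err(a ⊕ b)` and `a + b = x + y` with `x = a ⊕ b` — any tie rule,
gradual underflow. [cite: Shewchuk1997, Thm 6 p. 312–313] -/
theorem fastTwoSum_exact (hp : 1 ≤ p) (hfl : IsRoundNearest p emin fl) {a b : ℚ}
    (ha : IsFloat p emin a) (hb : IsFloat p emin b) (hab : |b| ≤ |a|) :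
    (fastTwoSum fl a b).1 = fl (a + b) ∧ fl (fl (a + b) - a) = fl (a + b) - a ∧
      (fastTwoSum fl a b).2 = a + b - fl (a + b) ∧
      (fastTwoSum fl a b).1 + (fastTwoSum fl a b).2 = a + b :=
  ⟨rfl, fast2Sum_correct hp hfl ha hb hab⟩

/-- Both outputs of FAST-TWO-SUM are floats. [cite: Shewchuk1997, Thm 6 p. 312] -/
theorem isFloat_fastTwoSum (hfl : IsRoundNearest p emin fl) (a b : ℚ) :
    IsFloat p emin (fastTwoSum fl a b).1 ∧ IsFloat p emin (fastTwoSum fl a b).2 :=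
  ⟨(hfl _).1, (hfl _).1⟩

/-- **ROUNDOFF LIES BELOW THE ROUNDED VALUE** (the last sentence of the proofs of Theorems 6 and
7, for ANY round-to-nearest and ANY rational `t`): `fl t` is an integer multiple of
`ulp(t) = 2^k` [BoldoEtAl2023, §2.1] and `|t − fl t| ≤ ½ulp < 2^k`, so `t − fl t` lies 1-below
`fl t`. [cite: Shewchuk1997, Thm 6 p. 313 ("Exact rounding guarantees that |y| ≤ ½ulp(x), so x and
y are nonoverlapping")] -/
theorem below_one_sub_fl (hp : 1 ≤ p) (hfl : IsRoundNearest p emin fl) (t : ℚ) :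
    Below 1 (t - fl t) (fl t) := by
  obtain ⟨k, -, hu⟩ := exists_ulp_eq_two_zpow (p := p) (emin := emin) t
  obtain ⟨K, hK⟩ := exists_fl_eq_int_mul_ulp hp hfl t
  have h := abs_sub_fl_le_half_ulp hp hfl t
  rw [hu] at h hK
  have h2k : (0 : ℚ) < (2 : ℚ) ^ k := zpow_pos (by norm_num) _
  exact ⟨k, ⟨K, hK⟩, by linarith⟩

/-- **COROLLARY 9, the mechanism, for every rational `t`**: under round-to-even, `t − RNₑ(t)` lies
2-below `RNₑ(t)` — "If the inequality is strict, `x` and `y` are nonadjacent. If `y = ½ulp(x)`,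
the round-to-even rule ensures that the least significant bit of the significand of `x` is zero".
[cite: Shewchuk1997, Cor 9 p. 315] -/
theorem below_two_sub_roundTiesEven (t : ℚ) :
    Below 2 (t - roundTiesEven p emin t) (roundTiesEven p emin t) := by
  obtain ⟨k, -, hu⟩ := exists_ulp_eq_two_zpow (p := p) (emin := emin) t
  set u : ℚ := ulp p emin t with hudef
  set N : ℤ := ⌊t / u⌋ with hN
  have h2k : (0 : ℚ) < (2 : ℚ) ^ k := zpow_pos (by norm_num) _
  have hle := abs_sub_roundTiesEven_le (p := p) (emin := emin) t
  rw [← hudef, ← hN] at hle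
  by_cases htie : t - (N : ℚ) * u = ((N : ℚ) + 1) * u - t
  · -- tie: the returned scaled significand is even, so `RNₑ t ∈ 2^(k+1)·ℤ`, and `2|y| = u = 2^k`
    have hR := roundTiesEven_of_tie (p := p) (emin := emin) (t := t) (by rw [← hudef, ← hN]; exact htie)
    rw [← hudef, ← hN] at hR
    have habs : 2 * |t - roundTiesEven p emin t| ≤ u := by
      have h1 := hle.1; have h2 := hle.2
      have : t - (N : ℚ) * u + (((N : ℚ) + 1) * u - t) = u := by ring
      linarith
    obtain ⟨M, hM⟩ : ∃ M : ℤ, roundTiesEven p emin t = (M : ℚ) * (2 : ℚ) ^ (k + 1) := by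
      by_cases hev : Even N
      · rw [if_pos hev] at hR
        obtain ⟨M, hM⟩ := hev
        refine ⟨M, ?_⟩
        rw [hR, hM, hu, zpow_add_one₀ (by norm_num : (2 : ℚ) ≠ 0)]; push_cast; ring
      · rw [if_neg hev] at hR
        obtain ⟨M, hM⟩ := Int.not_even_iff_odd.mp hev
        refine ⟨M + 1, ?_⟩
        rw [hR, hu, zpow_add_one₀ (by norm_num : (2 : ℚ) ≠ 0), hM]; push_cast; ring
    refine ⟨k + 1, ⟨M, hM⟩, ?_⟩
    rw [zpow_add_one₀ (by norm_num : (2 : ℚ) ≠ 0), ← hu]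
    linarith [ulp_pos (p := p) (emin := emin) t]
  · -- no tie: `|y| < u/2`, and `RNₑ t ∈ {N u, (N+1) u} ⊂ 2^k·ℤ`
    have habs : 2 * |t - roundTiesEven p emin t| < u := by
      have h1 := hle.1; have h2 := hle.2
      have hsum : t - (N : ℚ) * u + (((N : ℚ) + 1) * u - t) = u := by ring
      rcases lt_or_gt_of_ne htie with hlt | hlt
      · linarith
      · linarith
    obtain ⟨M, hM⟩ : ∃ M : ℤ, roundTiesEven p emin t = (M : ℚ) * (2 : ℚ) ^ k := by
      rcases roundTiesEven_eq_or (p := p) (emin := emin) t with h | h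
      · exact ⟨N, by rw [h, ← hudef, ← hN, hu]⟩
      · exact ⟨N + 1, by rw [h, ← hudef, ← hN, hu]; push_cast; ring⟩
    exact ⟨k, ⟨M, hM⟩, by rw [← hu]; exact habs⟩

/-- "**EXACT ROUNDING WITH ROUND-TO-EVEN TIEBREAKING**" as a property of the rounding map that
the expansion algorithms consume: every roundoff `t − fl t` lies `c`-below the rounded value.
`c = 1` holds for every round-to-nearest (`roundoffBelow_one`), `c = 2` for round-to-even
(`roundoffBelow_two_roundTiesEven`). [cite: Shewchuk1997, §2.1 p. 310; Cor 9 p. 315] -/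
def RoundoffBelow (c : ℚ) (fl : ℚ → ℚ) : Prop := ∀ t : ℚ, Below c (t - fl t) (fl t)

/-- Any round-to-nearest has its roundoff 1-below the rounded value ("|err(a ⊕ b)| ≤ ½ulp(a ⊕ b)").
[cite: Shewchuk1997, §2.1 p. 310; Thm 6 p. 313] -/
theorem roundoffBelow_one (hp : 1 ≤ p) (hfl : IsRoundNearest p emin fl) : RoundoffBelow 1 fl :=
  below_one_sub_fl hp hfl

/-- Round-to-even has its roundoff 2-below the rounded value. [cite: Shewchuk1997, Cor 9 p. 315] -/
theorem roundoffBelow_two_roundTiesEven (p : ℕ) (emin : ℤ) :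
    RoundoffBelow 2 (roundTiesEven p emin) :=
  below_two_sub_roundTiesEven

/-- **THEOREM 6, "x and y are nonoverlapping"** (indeed `y` lies 1-below `x`): FAST-TWO-SUM on floats
`|a| ≥ |b|`, any tie rule. [cite: Shewchuk1997, Thm 6 p. 312–313] -/
theorem fastTwoSum_below (hp : 1 ≤ p) (hfl : IsRoundNearest p emin fl) {c : ℚ}
    (hflc : RoundoffBelow c fl) {a b : ℚ} (ha : IsFloat p emin a) (hb : IsFloat p emin b)
    (hab : |b| ≤ |a|) : Below c (fastTwoSum fl a b).2 (fastTwoSum fl a b).1 := by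
  rw [(fastTwoSum_exact hp hfl ha hb hab).2.2.1]; exact hflc (a + b)

/-- **THEOREM 6**: `x = a ⊕ b` and `y` are nonoverlapping (floats `|a| ≥ |b|`, any tie rule).
[cite: Shewchuk1997, Thm 6 p. 312] -/
theorem fastTwoSum_nonoverlapping (hp : 1 ≤ p) (hfl : IsRoundNearest p emin fl) {a b : ℚ}
    (ha : IsFloat p emin a) (hb : IsFloat p emin b) (hab : |b| ≤ |a|) :
    Nonoverlapping (fastTwoSum fl a b).1 (fastTwoSum fl a b).2 :=
  nonoverlapping_comm.mp (fastTwoSum_below hp hfl (roundoffBelow_one hp hfl) ha hb hab).nonoverlapping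

/-- **FAST-TWO-DIFF(a, b)**: `x ⇐ a ⊖ b`; `b_virtual ⇐ a ⊖ x`; `y ⇐ b_virtual ⊖ b`.
[cite: Shewchuk1997, §2.3 p. 313] -/
def fastTwoDiff (fl : ℚ → ℚ) (a b : ℚ) : ℚ × ℚ :=
  let x := fl (a - b)
  let bvirtual := fl (a - x)
  (x, fl (bvirtual - b))

/-- **FAST-TWO-DIFF is exact** for floats `|a| ≥ |b|` ("The proof of the correctness of this
sequence is analogous to Theorem 6"): `b_virtual = a − x`, `y = (a − b) − x`, `x + y = a − b`.
[cite: Shewchuk1997, §2.3 p. 313] -/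
theorem fastTwoDiff_exact (hp : 1 ≤ p) (hfl : IsRoundNearest p emin fl) {a b : ℚ}
    (ha : IsFloat p emin a) (hb : IsFloat p emin b) (hab : |b| ≤ |a|) :
    (fastTwoDiff fl a b).1 = fl (a - b) ∧ fl (a - fl (a - b)) = a - fl (a - b) ∧
      (fastTwoDiff fl a b).2 = a - b - fl (a - b) ∧
      (fastTwoDiff fl a b).1 + (fastTwoDiff fl a b).2 = a - b := by
  have h1 : IsFloat p emin (fl (a - b) - a) := by
    have := isFloat_fl_add_sub_left hfl ha hb.neg (by rwa [abs_neg]); rwa [← sub_eq_add_neg] at this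
  have h2 : fl (a - fl (a - b)) = a - fl (a - b) :=
    fl_eq_self hfl (by have := h1.neg; rwa [neg_sub] at this)
  have h3 : IsFloat p emin (a - b - fl (a - b)) := by
    have := isFloat_add_sub_fl hp hfl ha hb.neg; rwa [← sub_eq_add_neg] at this
  have h4 : (fastTwoDiff fl a b).2 = a - b - fl (a - b) := by
    show fl (fl (a - fl (a - b)) - b) = a - b - fl (a - b)
    rw [h2, show a - fl (a - b) - b = a - b - fl (a - b) by ring, fl_eq_self hfl h3]
  exact ⟨rfl, h2, h4, by rw [h4]; show fl (a - b) + (a - b - fl (a - b)) = a - b; ring⟩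

/-- **TWO-SUM(a, b)** (Knuth): `x ⇐ a ⊕ b`; `b_virtual ⇐ x ⊖ a`; `a_virtual ⇐ x ⊖ b_virtual`;
`b_roundoff ⇐ b ⊖ b_virtual`; `a_roundoff ⇐ a ⊖ a_virtual`; `y ⇐ a_roundoff ⊕ b_roundoff`;
`return (x, y)`. [cite: Shewchuk1997, Thm 7 p. 314] -/
def twoSum (fl : ℚ → ℚ) (a b : ℚ) : ℚ × ℚ :=
  let x := fl (a + b)
  let bvirtual := fl (x - a)
  let avirtual := fl (x - bvirtual)
  let broundoff := fl (b - bvirtual)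
  let aroundoff := fl (a - avirtual)
  (x, fl (aroundoff + broundoff))

/-- Line 1 of TWO-SUM: `x = a ⊕ b`. [cite: Shewchuk1997, Thm 7 p. 314] -/
theorem twoSum_fst (fl : ℚ → ℚ) (a b : ℚ) : (twoSum fl a b).1 = fl (a + b) := rfl

/-- Shewchuk's TWO-SUM(a, b) is the survey's `2Sum(b, a)` [BoldoEtAl2023, Algorithm 2] (the roles of
the two operands are exchanged; the two commuted sums are the same rational numbers).
[cite: Shewchuk1997, Thm 7 p. 314] -/
theorem twoSum_eq_twoSum_swap (fl : ℚ → ℚ) (a b : ℚ) :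
    twoSum fl a b = BoldoJeannerodMelquiondMuller2023.twoSum fl b a := by
  show (fl (a + b), fl (fl (a - fl (fl (a + b) - fl (fl (a + b) - a))) +
      fl (b - fl (fl (a + b) - a)))) =
    (fl (b + a), fl (fl (b - fl (fl (b + a) - a)) +
      fl (a - fl (fl (b + a) - fl (fl (b + a) - a)))))
  rw [add_comm b a]
  congr 1
  congr 1
  exact add_comm _ _

/-- **THEOREM 7 (TWO-SUM is exact)** for ALL floats `a`, `b`: `y = −err(a ⊕ b)`, `a + b = x + y`,
`x = a ⊕ b` — any tie rule, gradual underflow, `p ≥ 1` (printed: `p ≥ 3`).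
[cite: Shewchuk1997, Thm 7 p. 314–315] -/
theorem twoSum_exact (hp : 1 ≤ p) (hfl : IsRoundNearest p emin fl) {a b : ℚ}
    (ha : IsFloat p emin a) (hb : IsFloat p emin b) :
    (twoSum fl a b).2 = a + b - fl (a + b) ∧ (twoSum fl a b).1 + (twoSum fl a b).2 = a + b := by
  have h : (twoSum fl a b).2 = a + b - fl (a + b) := by
    rw [twoSum_eq_twoSum_swap, twoSum_snd_eq hp hfl hb ha, add_comm b a]
  exact ⟨h, by rw [h, twoSum_fst]; ring⟩

/-- Both outputs of TWO-SUM are floats. [cite: Shewchuk1997, Thm 7 p. 314] -/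
theorem isFloat_twoSum (hfl : IsRoundNearest p emin fl) (a b : ℚ) :
    IsFloat p emin (twoSum fl a b).1 ∧ IsFloat p emin (twoSum fl a b).2 :=
  ⟨(hfl _).1, (hfl _).1⟩

/-- **THEOREM 7, "x and y are nonoverlapping" / COROLLARY 9, "nonadjacent"**, in the oriented form the
expansion algorithms use: `y` lies `c`-below `x` whenever the rounding has `RoundoffBelow c`.
[cite: Shewchuk1997, Thm 7 p. 314; Cor 9 p. 315] -/
theorem twoSum_below (hp : 1 ≤ p) (hfl : IsRoundNearest p emin fl) {c : ℚ}
    (hflc : RoundoffBelow c fl) {a b : ℚ} (ha : IsFloat p emin a) (hb : IsFloat p emin b) :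
    Below c (twoSum fl a b).2 (twoSum fl a b).1 := by
  rw [(twoSum_exact hp hfl ha hb).1, twoSum_fst]; exact hflc (a + b)

/-- **THEOREM 7**: `x = a ⊕ b` and `y` are nonoverlapping (any tie rule).
[cite: Shewchuk1997, Thm 7 p. 314] -/
theorem twoSum_nonoverlapping (hp : 1 ≤ p) (hfl : IsRoundNearest p emin fl) {a b : ℚ}
    (ha : IsFloat p emin a) (hb : IsFloat p emin b) :
    Nonoverlapping (twoSum fl a b).1 (twoSum fl a b).2 :=
  nonoverlapping_comm.mp (twoSum_below hp hfl (roundoffBelow_one hp hfl) ha hb).nonoverlapping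

/-- **COROLLARY 9.** "Let `x` and `y` be the values returned by FAST-TWO-SUM or TWO-SUM. On a machine
whose arithmetic uses round-to-even tiebreaking, `x` and `y` are nonadjacent."
[cite: Shewchuk1997, Cor 9 p. 315] -/
theorem twoSum_nonadjacent (hp : 1 ≤ p) {a b : ℚ} (ha : IsFloat p emin a) (hb : IsFloat p emin b) :
    Nonadjacent (twoSum (roundTiesEven p emin) a b).2 (twoSum (roundTiesEven p emin) a b).1 ∧
      (|b| ≤ |a| → Nonadjacent (fastTwoSum (roundTiesEven p emin) a b).2
        (fastTwoSum (roundTiesEven p emin) a b).1) :=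
  ⟨(twoSum_below hp (isRoundNearest_roundTiesEven hp) (roundoffBelow_two_roundTiesEven p emin)
      ha hb).nonadjacent,
    fun hab => (fastTwoSum_below hp (isRoundNearest_roundTiesEven hp)
      (roundoffBelow_two_roundTiesEven p emin) ha hb hab).nonadjacent⟩

/-- **COROLLARY 8 (a)** for the pair `x = a ⊕ b`, `y = a + b − x` (`a`, `b` floats), EVERY integer
`i`: "If `|y| ≥ 2^i` for some integer `i`, then `|x + y| ≥ 2^i(2^p + 1)`."  (For `i < emin` the
nonzero float `y` has `|y| ≥ 2^emin` and the case `i = emin` applies.)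
[cite: Shewchuk1997, Cor 8(a) p. 315] -/
theorem le_abs_add_of_two_zpow_le_abs_err (hp : 1 ≤ p) (hfl : IsRoundNearest p emin fl) {a b : ℚ}
    (ha : IsFloat p emin a) (hb : IsFloat p emin b) {i : ℤ}
    (hy : (2 : ℚ) ^ i ≤ |a + b - fl (a + b)|) : (2 : ℚ) ^ i * (2 ^ p + 1) ≤ |a + b| := by
  by_contra hlt
  rw [not_le] at hlt
  have h2 : (0 : ℚ) < 2 := by norm_num
  rcases le_or_gt emin i with hi | hi
  · exact absurd (abs_err_lt_two_zpow hp hfl hi hlt) (not_lt.mpr hy)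
  · have hy0 : a + b - fl (a + b) ≠ 0 := by
      intro h0; rw [h0, abs_zero] at hy; exact absurd hy (not_le.mpr (zpow_pos h2 _))
    have hgrid : OnGrid emin (a + b - fl (a + b)) :=
      ((OnGrid.of_isFloat ha).add (OnGrid.of_isFloat hb)).sub (OnGrid.of_isFloat (hfl _).1)
    have hge := hgrid.two_zpow_le_abs hy0
    have hii : (2 : ℚ) ^ i ≤ (2 : ℚ) ^ emin := zpow_le_zpow_right₀ (by norm_num) hi.le
    have hlt' : |a + b| < (2 : ℚ) ^ emin * (2 ^ p + 1) :=
      lt_of_lt_of_le hlt (mul_le_mul_of_nonneg_right hii (by positivity))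
    exact absurd (abs_err_lt_two_zpow hp hfl le_rfl hlt') (not_lt.mpr hge)

/-- **COROLLARY 8 (b)**, every integer `i`: "If `|y| > 2^i` for some integer `i`, then
`|x + y| > 2^i(2^(p+1) + 1)`." [cite: Shewchuk1997, Cor 8(b) p. 315] -/
theorem lt_abs_add_of_two_zpow_lt_abs_err (hp : 1 ≤ p) (hfl : IsRoundNearest p emin fl) {a b : ℚ}
    (ha : IsFloat p emin a) (hb : IsFloat p emin b) {i : ℤ}
    (hy : (2 : ℚ) ^ i < |a + b - fl (a + b)|) : (2 : ℚ) ^ i * (2 ^ (p + 1) + 1) < |a + b| := by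
  by_contra hle
  rw [not_lt] at hle
  have h2 : (0 : ℚ) < 2 := by norm_num
  rcases le_or_gt emin (i + 1) with hi | hi
  · exact absurd (abs_err_le_two_zpow hp hfl hi hle) (not_le.mpr hy)
  · have hy0 : a + b - fl (a + b) ≠ 0 := by
      intro h0; rw [h0, abs_zero] at hy; exact absurd hy (not_lt.mpr (zpow_pos h2 _).le)
    have hgrid : OnGrid emin (a + b - fl (a + b)) :=
      ((OnGrid.of_isFloat ha).add (OnGrid.of_isFloat hb)).sub (OnGrid.of_isFloat (hfl _).1)
    have hge := hgrid.two_zpow_le_abs hy0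
    have hii : (2 : ℚ) ^ i ≤ (2 : ℚ) ^ (emin - 1) := zpow_le_zpow_right₀ (by norm_num) (by omega)
    have hle' : |a + b| ≤ (2 : ℚ) ^ (emin - 1) * (2 ^ (p + 1) + 1) :=
      le_trans hle (mul_le_mul_of_nonneg_right hii (by positivity))
    have h1 := abs_err_le_two_zpow hp hfl (i := emin - 1) (by omega) hle'
    have : (2 : ℚ) ^ (emin - 1) < (2 : ℚ) ^ emin := zpow_lt_zpow_right₀ (by norm_num) (by omega)
    linarith

/-- **COROLLARY 8 for TWO-SUM's outputs** `(x, y)`: (a) `|y| ≥ 2^i ⟹ |x + y| ≥ 2^i(2^p + 1)`,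
(b) `|y| > 2^i ⟹ |x + y| > 2^i(2^(p+1) + 1)`. [cite: Shewchuk1997, Cor 8 p. 315] -/
theorem twoSum_cor8 (hp : 1 ≤ p) (hfl : IsRoundNearest p emin fl) {a b : ℚ}
    (ha : IsFloat p emin a) (hb : IsFloat p emin b) (i : ℤ) :
    ((2 : ℚ) ^ i ≤ |(twoSum fl a b).2| →
        (2 : ℚ) ^ i * (2 ^ p + 1) ≤ |(twoSum fl a b).1 + (twoSum fl a b).2|) ∧
      ((2 : ℚ) ^ i < |(twoSum fl a b).2| →
        (2 : ℚ) ^ i * (2 ^ (p + 1) + 1) < |(twoSum fl a b).1 + (twoSum fl a b).2|) := by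
  obtain ⟨hy, hsum⟩ := twoSum_exact hp hfl ha hb
  rw [hsum, hy]
  exact ⟨le_abs_add_of_two_zpow_le_abs_err hp hfl ha hb, lt_abs_add_of_two_zpow_lt_abs_err hp hfl ha hb⟩

/-- **ZERO COMPONENTS, "pipeline delay"**: "the effect of a zero input component is always to
produce a zero output component without changing the value of the accumulator":
TWO-SUM(Q, 0) = (Q, 0) for a float `Q`. [cite: Shewchuk1997, §2.4 p. 316–317] -/
theorem twoSum_zero_right (hfl : IsRoundNearest p emin fl) {Q : ℚ} (hQ : IsFloat p emin Q) :
    twoSum fl Q 0 = (Q, 0) := by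
  have h0 : fl 0 = 0 := fl_zero hfl
  have hQ' : fl Q = Q := fl_eq_self hfl hQ
  show (fl (Q + 0), fl (fl (Q - fl (fl (Q + 0) - fl (fl (Q + 0) - Q))) +
      fl (0 - fl (fl (Q + 0) - Q)))) = (Q, 0)
  rw [add_zero, hQ', sub_self, h0, sub_zero, hQ', sub_self, h0, sub_self, h0, add_zero, h0]

/-! ### §2.4 Expansion addition: GROW-EXPANSION (Theorem 10) -/

/-- **GROW-EXPANSION(e, b)**: `Q₀ ⇐ b`; `for i ⇐ 1 to m: (Qᵢ, hᵢ) ⇐ TWO-SUM(Qᵢ₋₁, eᵢ)`;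
`h_{m+1} ⇐ Q_m`; `return h` — on the component list `e = [e₁, …, e_m]` (smallest first) it
returns `[h₁, …, h_m, h_{m+1}]`. [cite: Shewchuk1997, Thm 10 p. 316 (Fig. 6)] -/
def growExpansion (fl : ℚ → ℚ) : List ℚ → ℚ → List ℚ
  | [], Q => [Q]
  | e :: es, Q => (twoSum fl Q e).2 :: growExpansion fl es (twoSum fl Q e).1

/-- GROW-EXPANSION of the empty expansion returns `[b]` (`h₁ ⇐ Q₀ = b`).
[cite: Shewchuk1997, Thm 10 p. 316 (Fig. 6)] -/
@[simp] theorem growExpansion_nil (fl : ℚ → ℚ) (b : ℚ) : growExpansion fl [] b = [b] := rfl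

/-- One loop iteration of GROW-EXPANSION: `(Q₁, h₁) ⇐ TWO-SUM(Q₀, e₁)`, then continue with `Q₁`.
[cite: Shewchuk1997, Thm 10 p. 316 (Fig. 6)] -/
@[simp] theorem growExpansion_cons (fl : ℚ → ℚ) (e : ℚ) (es : List ℚ) (b : ℚ) :
    growExpansion fl (e :: es) b = (twoSum fl b e).2 :: growExpansion fl es (twoSum fl b e).1 := rfl

/-- GROW-EXPANSION returns a nonempty list. [cite: Shewchuk1997, Thm 10 p. 316] -/
theorem growExpansion_ne_nil (fl : ℚ → ℚ) (e : List ℚ) (b : ℚ) : growExpansion fl e b ≠ [] := by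
  cases e <;> simp

/-- GROW-EXPANSION returns `m + 1` components. [cite: Shewchuk1997, Thm 10 p. 316] -/
theorem length_growExpansion (fl : ℚ → ℚ) (e : List ℚ) (b : ℚ) :
    (growExpansion fl e b).length = e.length + 1 := by
  induction e generalizing b with
  | nil => rfl
  | cons e es ih => simp [ih]

/-- "`h_{m+1} ⇐ Q_m`", where "`Qᵢ` is an approximate sum of `b` and the first `i` components of `e`"
(`Qᵢ = Qᵢ₋₁ ⊕ eᵢ`): the last output component is the running rounded sum.
[cite: Shewchuk1997, Thm 10 p. 316–317] -/
theorem getLast_growExpansion (fl : ℚ → ℚ) (e : List ℚ) (b : ℚ) :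
    (growExpansion fl e b).getLast (growExpansion_ne_nil fl e b) =
      e.foldl (fun Q x => fl (Q + x)) b := by
  induction e generalizing b with
  | nil => rfl
  | cons e es ih =>
    simp only [growExpansion_cons, List.foldl_cons]
    rw [List.getLast_cons (growExpansion_ne_nil fl es _), ih]
    rfl

/-- Every output component of GROW-EXPANSION is a float. [cite: Shewchuk1997, Thm 10 p. 316] -/
theorem isFloat_of_mem_growExpansion (hfl : IsRoundNearest p emin fl) {e : List ℚ} {b : ℚ}
    (hb : IsFloat p emin b) : ∀ x ∈ growExpansion fl e b, IsFloat p emin x := by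
  induction e generalizing b with
  | nil => simpa using hb
  | cons e es ih =>
    intro x hx
    rcases List.mem_cons.mp hx with rfl | hx
    · exact (hfl _).1
    · exact ih (hfl _).1 x hx

/-- **THEOREM 10, "h = Σ hᵢ = e + b"** (the `Q` invariant `Qᵢ + Σ_{j≤i} hⱼ = b + Σ_{j≤i} eⱼ`): the
output of GROW-EXPANSION sums exactly to `b + Σ eᵢ`, for ANY round-to-nearest.
[cite: Shewchuk1997, Thm 10 p. 316–317] -/
theorem sum_growExpansion (hp : 1 ≤ p) (hfl : IsRoundNearest p emin fl) {e : List ℚ} {b : ℚ}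
    (hb : IsFloat p emin b) (he : ∀ x ∈ e, IsFloat p emin x) :
    (growExpansion fl e b).sum = b + e.sum := by
  induction e generalizing b with
  | nil => simp
  | cons e es ih =>
    obtain ⟨heF, hesF⟩ := List.forall_mem_cons.mp he
    have hQF : IsFloat p emin (twoSum fl b e).1 := (hfl _).1
    rw [growExpansion_cons, List.sum_cons, ih hQF hesF, List.sum_cons,
      (twoSum_exact hp hfl hb heF).1, twoSum_fst]
    ring

/-- The GRID INVARIANT of GROW-EXPANSION: if `b` and every `eᵢ` are integer multiples of `2^s`
(`s ≥ emin`), so is every output component (rounded sums of multiples of `2^s` and their exact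
errors stay on the grid). [cite: Shewchuk1997, Thm 10 p. 317 (proof)] -/
theorem onGrid_of_mem_growExpansion (hp : 1 ≤ p) (hfl : IsRoundNearest p emin fl) {s : ℤ}
    (hs : emin ≤ s) {e : List ℚ} {b : ℚ} (hb : IsFloat p emin b) (he : ∀ x ∈ e, IsFloat p emin x)
    (hbG : OnGrid s b) (heG : ∀ x ∈ e, OnGrid s x) :
    ∀ x ∈ growExpansion fl e b, OnGrid s x := by
  induction e generalizing b with
  | nil => simpa using hbG
  | cons e es ih =>
    obtain ⟨heF, hesF⟩ := List.forall_mem_cons.mp he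
    obtain ⟨heG1, hesG⟩ := List.forall_mem_cons.mp heG
    have hQ : OnGrid s (fl (b + e)) := (hbG.add heG1).fl_of hp hfl hs
    have hh : OnGrid s (twoSum fl b e).2 := by
      rw [(twoSum_exact hp hfl hb heF).1]; exact (hbG.add heG1).sub hQ
    intro x hx
    rcases List.mem_cons.mp hx with rfl | hx
    · exact hh
    · exact ih (hfl _).1 hesF hQ hesG x hx

/-- A finite family of floats each having `x` `c`-below it lies on ONE grid `2^g` with
`c·|x| < 2^g`, `emin ≤ g ≤ g₀` (take the coarsest common quantum).
[cite: Shewchuk1997, Thm 10 p. 317 (proof)] -/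
theorem exists_common_grid {c x : ℚ} {l : List ℚ} (hl : ∀ y ∈ l, IsFloat p emin y)
    (hb : ∀ y ∈ l, Below c x y) {g₀ : ℤ} (hg₀ : emin ≤ g₀) (hx : c * |x| < (2 : ℚ) ^ g₀) :
    ∃ g : ℤ, emin ≤ g ∧ g ≤ g₀ ∧ c * |x| < (2 : ℚ) ^ g ∧ ∀ y ∈ l, OnGrid g y := by
  induction l with
  | nil => exact ⟨g₀, hg₀, le_rfl, hx, by simp⟩
  | cons y l ih =>
    obtain ⟨hyF, hlF⟩ := List.forall_mem_cons.mp hl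
    obtain ⟨hyB, hlB⟩ := List.forall_mem_cons.mp hb
    obtain ⟨g', hg', hg'0, hcg', hlG⟩ := ih hlF hlB
    obtain ⟨s, hs, hyG, hcs⟩ := hyB.normalize hyF
    refine ⟨min g' s, le_min hg' hs, (min_le_left _ _).trans hg'0, ?_, ?_⟩
    · rcases min_choice g' s with h | h <;> rw [h] <;> assumption
    · intro z hz
      rcases List.mem_cons.mp hz with rfl | hz
      · exact hyG.mono (min_le_right _ _)
      · exact (hlG z hz).mono (min_le_left _ _)

/-- **THEOREM 10 (GROW-EXPANSION), the structural half, for a rounding with `RoundoffBelow c`**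
(`c ≥ 0`): if `e` is a `c`-expansion of floats and `b` a float then `h` is a `c`-expansion — "the
output of TWO-SUM has the property that `hᵢ` and `Qᵢ` do not overlap [lie `c`-apart]. By Lemma 1,
`|hᵢ| ≤ |eᵢ|`, and ... `hᵢ` cannot overlap any of `eᵢ₊₁, eᵢ₊₂, …`. It follows that `hᵢ` cannot
overlap any of the later components of `h`, because these are constructed by summing `Qᵢ` with later
`e` components."  [cite: Shewchuk1997, Thm 10 p. 316–317] -/
theorem isExpansion_growExpansion (hp : 1 ≤ p) (hfl : IsRoundNearest p emin fl) {c : ℚ}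
    (hc : 0 ≤ c) (hflc : RoundoffBelow c fl) {e : List ℚ} {b : ℚ} (hb : IsFloat p emin b)
    (he : ∀ x ∈ e, IsFloat p emin x) (hexp : IsExpansion c e) :
    IsExpansion c (growExpansion fl e b) := by
  induction e generalizing b with
  | nil => exact isExpansion_singleton c b
  | cons e es ih =>
    obtain ⟨heF, hesF⟩ := List.forall_mem_cons.mp he
    obtain ⟨he1, hes⟩ := isExpansion_cons.mp hexp
    rw [growExpansion_cons, isExpansion_cons]
    have hQF : IsFloat p emin (twoSum fl b e).1 := (hfl _).1
    have hh_eq : (twoSum fl b e).2 = b + e - fl (b + e) := (twoSum_exact hp hfl hb heF).1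
    have hhQ : Below c (twoSum fl b e).2 (twoSum fl b e).1 := twoSum_below hp hfl hflc hb heF
    have hh_le : |(twoSum fl b e).2| ≤ |e| := by
      rw [hh_eq, abs_sub_comm]; exact (abs_err_add_le hfl hb heF).2
    obtain ⟨k, hk, hQk, hck⟩ := hhQ.normalize hQF
    obtain ⟨g, hg, hgk, hcg, hesG⟩ :=
      exists_common_grid hesF (fun y hy => (he1 y hy).mono_left hc hh_le) hk hck
    exact ⟨fun z hz => ⟨g, onGrid_of_mem_growExpansion hp hfl hg hQF hesF (hQk.mono hgk) hesG z hz,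
      hcg⟩, ih hQF hesF hes⟩

/-- **COROLLARY 11.** "The first `m` components of `h` are each no larger than the corresponding
component of `e`. (That is, `|h₁| ≤ |e₁|, |h₂| ≤ |e₂|, …, |h_m| ≤ |e_m|`.)"
[cite: Shewchuk1997, Cor 11 p. 317] -/
theorem abs_growExpansion_le (hp : 1 ≤ p) (hfl : IsRoundNearest p emin fl) {e : List ℚ} {b : ℚ}
    (hb : IsFloat p emin b) (he : ∀ x ∈ e, IsFloat p emin x) :
    List.Forall₂ (fun h x => |h| ≤ |x|) (growExpansion fl e b).dropLast e := by
  induction e generalizing b with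
  | nil => simp
  | cons e es ih =>
    obtain ⟨heF, hesF⟩ := List.forall_mem_cons.mp he
    rw [growExpansion_cons, List.dropLast_cons_of_ne_nil (growExpansion_ne_nil fl es _)]
    refine List.Forall₂.cons ?_ (ih (hfl _).1 hesF)
    rw [(twoSum_exact hp hfl hb heF).1, abs_sub_comm]; exact (abs_err_add_le hfl hb heF).2

/-- **COROLLARY 11, "Furthermore, |h₁| ≤ |b|."** [cite: Shewchuk1997, Cor 11 p. 317] -/
theorem abs_head_growExpansion_le (hp : 1 ≤ p) (hfl : IsRoundNearest p emin fl) {e₁ : ℚ}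
    {es : List ℚ} {b : ℚ} (hb : IsFloat p emin b) (he₁ : IsFloat p emin e₁) :
    |(growExpansion fl (e₁ :: es) b).head (growExpansion_ne_nil fl _ b)| ≤ |b| := by
  show |(twoSum fl b e₁).2| ≤ |b|
  rw [(twoSum_exact hp hfl hb he₁).1, abs_sub_comm]; exact (abs_err_add_le hfl hb he₁).1

/-- **THEOREM 10 (GROW-EXPANSION) as printed, any tie rule.** "Let `e = Σᵢ₌₁^m eᵢ` be a
nonoverlapping expansion of `m` `p`-bit components, and let `b` be a `p`-bit value ... sorted in
order of increasing magnitude, except that any of the `eᵢ` may be zero. Then [GROW-EXPANSION] will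
produce a nonoverlapping expansion `h` such that `h = Σᵢ₌₁^{m+1} hᵢ = e + b`, where the components
`h₁, …, h_{m+1}` are also in order of increasing magnitude, except that any of the `hᵢ` may be
zero." [cite: Shewchuk1997, Thm 10 p. 316] -/
theorem growExpansion_nonoverlapping (hp : 1 ≤ p) (hfl : IsRoundNearest p emin fl) {e : List ℚ}
    {b : ℚ} (hb : IsFloat p emin b) (he : ∀ x ∈ e, IsFloat p emin x) (hexp : IsExpansion 1 e) :
    IsExpansion 1 (growExpansion fl e b) ∧ (growExpansion fl e b).sum = b + e.sum ∧
      (growExpansion fl e b).length = e.length + 1 ∧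
      ∀ x ∈ growExpansion fl e b, IsFloat p emin x :=
  ⟨isExpansion_growExpansion hp hfl zero_le_one (roundoffBelow_one hp hfl) hb he hexp,
    sum_growExpansion hp hfl hb he, length_growExpansion fl e b, isFloat_of_mem_growExpansion hfl hb⟩

/-- **THEOREM 10, "Furthermore, if e is nonadjacent and round-to-even tiebreaking is used, then h is
nonadjacent."** [cite: Shewchuk1997, Thm 10 p. 316] -/
theorem growExpansion_nonadjacent (hp : 1 ≤ p) {e : List ℚ} {b : ℚ} (hb : IsFloat p emin b)
    (he : ∀ x ∈ e, IsFloat p emin x) (hexp : IsExpansion 2 e) :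
    IsExpansion 2 (growExpansion (roundTiesEven p emin) e b) ∧
      (growExpansion (roundTiesEven p emin) e b).sum = b + e.sum :=
  ⟨isExpansion_growExpansion hp (isRoundNearest_roundTiesEven hp) zero_le_two
      (roundoffBelow_two_roundTiesEven p emin) hb he hexp,
    sum_growExpansion hp (isRoundNearest_roundTiesEven hp) hb he⟩

/-! ### §2.4 Expansion addition: EXPANSION-SUM (Theorem 12) -/

/-- **EXPANSION-SUM(e, f)**: `h ⇐ e`; `for i ⇐ 1 to n: ⟨hᵢ, hᵢ₊₁, …, hᵢ₊ₘ⟩ ⇐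
GROW-EXPANSION(⟨hᵢ, hᵢ₊₁, …, hᵢ₊ₘ₋₁⟩, fᵢ)`; `return h` — the WINDOWED Line 3: component `fᵢ`
is grown into the current `m`-component window, whose smallest output `hᵢ` is final and whose other
`m` outputs form the next window.  Written out: the first TWO-SUM of that GROW-EXPANSION is
`TWO-SUM(fᵢ, window₁)`, its error is emitted, and the rest of the window is grown by its sum.
[cite: Shewchuk1997, Thm 12 p. 318 (Fig. 7)] -/
def expansionSum (fl : ℚ → ℚ) : List ℚ → List ℚ → List ℚ
  | e, [] => e
  | [], f :: fs => f :: expansionSum fl [] fs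
  | e₁ :: es, f :: fs =>
      (twoSum fl f e₁).2 :: expansionSum fl (growExpansion fl es (twoSum fl f e₁).1) fs

/-- `h ⇐ e` when `f` has no components. [cite: Shewchuk1997, Thm 12 p. 318 (Fig. 7)] -/
@[simp] theorem expansionSum_nil_right (fl : ℚ → ℚ) (e : List ℚ) : expansionSum fl e [] = e := by
  cases e <;> rfl

/-- With an empty window the components of `f` pass through.
[cite: Shewchuk1997, Thm 12 p. 318 (Fig. 7)] -/
@[simp] theorem expansionSum_nil_cons (fl : ℚ → ℚ) (f : ℚ) (fs : List ℚ) :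
    expansionSum fl [] (f :: fs) = f :: expansionSum fl [] fs := rfl

/-- One iteration of Line 3 of EXPANSION-SUM, written out.
[cite: Shewchuk1997, Thm 12 p. 318 (Fig. 7)] -/
@[simp] theorem expansionSum_cons_cons (fl : ℚ → ℚ) (e₁ : ℚ) (es : List ℚ) (f : ℚ) (fs : List ℚ) :
    expansionSum fl (e₁ :: es) (f :: fs) =
      (twoSum fl f e₁).2 :: expansionSum fl (growExpansion fl es (twoSum fl f e₁).1) fs := rfl

/-- "`h ⇐ e`" with an empty `f`, and symmetrically an empty `e` passes `f` through.
[cite: Shewchuk1997, Thm 12 p. 318] -/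
theorem expansionSum_nil_left (fl : ℚ → ℚ) (f : List ℚ) : expansionSum fl [] f = f := by
  induction f with
  | nil => rfl
  | cons f fs ih => rw [expansionSum_nil_cons, ih]

/-- **Line 3 literally**: one step of EXPANSION-SUM grows the current window by `fᵢ`, emits the
smallest output component and keeps the remaining `m` as the next window.
[cite: Shewchuk1997, Thm 12 p. 318 (Line 3)] -/
theorem expansionSum_cons_right (fl : ℚ → ℚ) (e : List ℚ) (f : ℚ) (fs : List ℚ) :
    expansionSum fl e (f :: fs) =
      (growExpansion fl e f).head (growExpansion_ne_nil fl e f) ::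
        expansionSum fl (growExpansion fl e f).tail fs := by
  cases e <;> rfl

/-- EXPANSION-SUM returns `m + n` components. [cite: Shewchuk1997, Thm 12 p. 318] -/
theorem length_expansionSum (fl : ℚ → ℚ) (e f : List ℚ) :
    (expansionSum fl e f).length = e.length + f.length := by
  induction f generalizing e with
  | nil => simp
  | cons f fs ih =>
    cases e with
    | nil => simp [expansionSum_nil_left]
    | cons e₁ es =>
      rw [expansionSum_cons_cons, List.length_cons, ih, length_growExpansion]
      simp only [List.length_cons]; omega

/-- Every output component of EXPANSION-SUM is a float. [cite: Shewchuk1997, Thm 12 p. 318] -/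
theorem isFloat_of_mem_expansionSum (hfl : IsRoundNearest p emin fl) {e f : List ℚ}
    (he : ∀ x ∈ e, IsFloat p emin x) (hf : ∀ x ∈ f, IsFloat p emin x) :
    ∀ x ∈ expansionSum fl e f, IsFloat p emin x := by
  induction f generalizing e with
  | nil => simpa using he
  | cons f fs ih =>
    obtain ⟨hfF, hfsF⟩ := List.forall_mem_cons.mp hf
    cases e with
    | nil => rw [expansionSum_nil_left]; exact hf
    | cons e₁ es =>
      rw [expansionSum_cons_cons]
      intro x hx
      rcases List.mem_cons.mp hx with rfl | hx
      · exact (hfl _).1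
      · exact ih (isFloat_of_mem_growExpansion hfl (hfl _).1) hfsF x hx

/-- **THEOREM 12, "h = Σ hᵢ = e + f"**: EXPANSION-SUM sums exactly, for ANY round-to-nearest.
[cite: Shewchuk1997, Thm 12 p. 318] -/
theorem sum_expansionSum (hp : 1 ≤ p) (hfl : IsRoundNearest p emin fl) {e f : List ℚ}
    (he : ∀ x ∈ e, IsFloat p emin x) (hf : ∀ x ∈ f, IsFloat p emin x) :
    (expansionSum fl e f).sum = e.sum + f.sum := by
  induction f generalizing e with
  | nil => simp
  | cons f fs ih =>
    obtain ⟨hfF, hfsF⟩ := List.forall_mem_cons.mp hf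
    cases e with
    | nil => rw [expansionSum_nil_left]; simp
    | cons e₁ es =>
      obtain ⟨he₁F, hesF⟩ := List.forall_mem_cons.mp he
      have hQF : IsFloat p emin (twoSum fl f e₁).1 := (hfl _).1
      rw [expansionSum_cons_cons, List.sum_cons,
        ih (isFloat_of_mem_growExpansion hfl hQF) hfsF,
        sum_growExpansion hp hfl hQF hesF, (twoSum_exact hp hfl hfF he₁F).1, twoSum_fst,
        List.sum_cons, List.sum_cons]
      ring

/-- The GRID INVARIANT of EXPANSION-SUM: inputs on the grid `2^s` (`s ≥ emin`) give outputs on the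
grid `2^s`. [cite: Shewchuk1997, Thm 12 p. 318 (proof)] -/
theorem onGrid_of_mem_expansionSum (hp : 1 ≤ p) (hfl : IsRoundNearest p emin fl) {s : ℤ}
    (hs : emin ≤ s) {e f : List ℚ} (he : ∀ x ∈ e, IsFloat p emin x)
    (hf : ∀ x ∈ f, IsFloat p emin x) (heG : ∀ x ∈ e, OnGrid s x) (hfG : ∀ x ∈ f, OnGrid s x) :
    ∀ x ∈ expansionSum fl e f, OnGrid s x := by
  induction f generalizing e with
  | nil => simpa using heG
  | cons f fs ih =>
    obtain ⟨hfF, hfsF⟩ := List.forall_mem_cons.mp hf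
    obtain ⟨hfG1, hfsG⟩ := List.forall_mem_cons.mp hfG
    cases e with
    | nil => rw [expansionSum_nil_left]; exact hfG
    | cons e₁ es =>
      obtain ⟨he₁F, hesF⟩ := List.forall_mem_cons.mp he
      obtain ⟨he₁G, hesG⟩ := List.forall_mem_cons.mp heG
      have hQ : OnGrid s (fl (f + e₁)) := (hfG1.add he₁G).fl_of hp hfl hs
      have hh : OnGrid s (twoSum fl f e₁).2 := by
        rw [(twoSum_exact hp hfl hfF he₁F).1]; exact (hfG1.add he₁G).sub hQ
      rw [expansionSum_cons_cons]
      intro x hx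
      rcases List.mem_cons.mp hx with rfl | hx
      · exact hh
      · exact ih (isFloat_of_mem_growExpansion hfl (hfl _).1) hfsF
          (onGrid_of_mem_growExpansion hp hfl hs (hfl _).1 hesF hQ hesG) hfsG x hx

/-- **THEOREM 12 (EXPANSION-SUM), the structural half, for a rounding with `RoundoffBelow c`**
(`c ≥ 0`): `c`-expansions `e`, `f` of floats give a `c`-expansion `h`.  The emitted `hᵢ` lies
`c`-below its `Qᵢ`, and (Lemma 1 / Corollary 11) `|hᵢ| ≤ |window₁|`, `|hᵢ| ≤ |fᵢ|`, so it lies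
`c`-below every remaining window component and every later `fⱼ` ("for any `j < i`, `hⱼ` cannot
overlap `fᵢ`"); all later outputs are rounded sums on the common grid of those numbers.
[cite: Shewchuk1997, Thm 12 p. 318] -/
theorem isExpansion_expansionSum (hp : 1 ≤ p) (hfl : IsRoundNearest p emin fl) {c : ℚ}
    (hc : 0 ≤ c) (hflc : RoundoffBelow c fl) {e f : List ℚ} (he : ∀ x ∈ e, IsFloat p emin x)
    (hf : ∀ x ∈ f, IsFloat p emin x) (hee : IsExpansion c e) (hff : IsExpansion c f) :
    IsExpansion c (expansionSum fl e f) := by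
  induction f generalizing e with
  | nil => simpa using hee
  | cons f fs ih =>
    obtain ⟨hfF, hfsF⟩ := List.forall_mem_cons.mp hf
    obtain ⟨hf1, hfs⟩ := isExpansion_cons.mp hff
    cases e with
    | nil => rw [expansionSum_nil_left]; exact hff
    | cons e₁ es =>
      obtain ⟨he₁F, hesF⟩ := List.forall_mem_cons.mp he
      obtain ⟨he1, hes⟩ := isExpansion_cons.mp hee
      rw [expansionSum_cons_cons, isExpansion_cons]
      have hQF : IsFloat p emin (twoSum fl f e₁).1 := (hfl _).1
      have hWF : ∀ x ∈ growExpansion fl es (twoSum fl f e₁).1, IsFloat p emin x :=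
        isFloat_of_mem_growExpansion hfl hQF
      have hW : IsExpansion c (growExpansion fl es (twoSum fl f e₁).1) :=
        isExpansion_growExpansion hp hfl hc hflc hQF hesF hes
      refine ⟨?_, ih hWF hfsF hW hfs⟩
      -- the emitted component lies `c`-below everything that follows
      have hh_eq : (twoSum fl f e₁).2 = f + e₁ - fl (f + e₁) := (twoSum_exact hp hfl hfF he₁F).1
      have hhQ : Below c (twoSum fl f e₁).2 (twoSum fl f e₁).1 := twoSum_below hp hfl hflc hfF he₁F
      have hh_le_e : |(twoSum fl f e₁).2| ≤ |e₁| := by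
        rw [hh_eq, abs_sub_comm]; exact (abs_err_add_le hfl hfF he₁F).2
      have hh_le_f : |(twoSum fl f e₁).2| ≤ |f| := by
        rw [hh_eq, abs_sub_comm]; exact (abs_err_add_le hfl hfF he₁F).1
      obtain ⟨k, hk, hQk, hck⟩ := hhQ.normalize hQF
      have hlF : ∀ y ∈ es ++ fs, IsFloat p emin y := by
        intro y hy
        rcases List.mem_append.mp hy with hy | hy
        · exact hesF y hy
        · exact hfsF y hy
      have hlB : ∀ y ∈ es ++ fs, Below c (twoSum fl f e₁).2 y := by
        intro y hy
        rcases List.mem_append.mp hy with hy | hy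
        · exact (he1 y hy).mono_left hc hh_le_e
        · exact (hf1 y hy).mono_left hc hh_le_f
      obtain ⟨g, hg, hgk, hcg, hlG⟩ := exists_common_grid hlF hlB hk hck
      have hesG : ∀ y ∈ es, OnGrid g y := fun y hy => hlG y (List.mem_append_left _ hy)
      have hfsG : ∀ y ∈ fs, OnGrid g y := fun y hy => hlG y (List.mem_append_right _ hy)
      have hWG : ∀ x ∈ growExpansion fl es (twoSum fl f e₁).1, OnGrid g x :=
        onGrid_of_mem_growExpansion hp hfl hg hQF hesF (hQk.mono hgk) hesG
      intro z hz
      exact ⟨g, onGrid_of_mem_expansionSum hp hfl hg hWF hfsF hWG hfsG z hz, hcg⟩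

/-- **THEOREM 12 (EXPANSION-SUM) as printed, any tie rule.** "Let `e = Σᵢ₌₁^m eᵢ` and
`f = Σᵢ₌₁ⁿ fᵢ` be nonoverlapping expansions of `m` and `n` `p`-bit components ... sorted in order
of increasing magnitude, except that any of the `eᵢ` or `fᵢ` may be zero. Then [EXPANSION-SUM]
will produce a nonoverlapping expansion `h` such that `h = Σᵢ₌₁^{m+n} hᵢ = e + f`, where the
components of `h` are in order of increasing magnitude, except that any of the `hᵢ` may be zero."
[cite: Shewchuk1997, Thm 12 p. 318] -/
theorem expansionSum_nonoverlapping (hp : 1 ≤ p) (hfl : IsRoundNearest p emin fl) {e f : List ℚ}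
    (he : ∀ x ∈ e, IsFloat p emin x) (hf : ∀ x ∈ f, IsFloat p emin x) (hee : IsExpansion 1 e)
    (hff : IsExpansion 1 f) :
    IsExpansion 1 (expansionSum fl e f) ∧ (expansionSum fl e f).sum = e.sum + f.sum ∧
      (expansionSum fl e f).length = e.length + f.length ∧
      ∀ x ∈ expansionSum fl e f, IsFloat p emin x :=
  ⟨isExpansion_expansionSum hp hfl zero_le_one (roundoffBelow_one hp hfl) he hf hee hff,
    sum_expansionSum hp hfl he hf, length_expansionSum fl e f, isFloat_of_mem_expansionSum hfl he hf⟩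

/-- **THEOREM 12, "Furthermore, if e and f are nonadjacent and round-to-even tiebreaking is used,
then h is nonadjacent."** [cite: Shewchuk1997, Thm 12 p. 318] -/
theorem expansionSum_nonadjacent (hp : 1 ≤ p) {e f : List ℚ} (he : ∀ x ∈ e, IsFloat p emin x)
    (hf : ∀ x ∈ f, IsFloat p emin x) (hee : IsExpansion 2 e) (hff : IsExpansion 2 f) :
    IsExpansion 2 (expansionSum (roundTiesEven p emin) e f) ∧
      (expansionSum (roundTiesEven p emin) e f).sum = e.sum + f.sum :=
  ⟨isExpansion_expansionSum hp (isRoundNearest_roundTiesEven hp) zero_le_two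
      (roundoffBelow_two_roundTiesEven p emin) he hf hee hff,
    sum_expansionSum hp (isRoundNearest_roundTiesEven hp) he hf⟩

end Literature.ComputerArithmetic.Shewchuk1997
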